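import Summits.ResolutionOfSingularities.ResolutionOfSingularities.Theorems.WeightedInvariantContactCylinderStratumLocalize
import Summits.ResolutionOfSingularities.ResolutionOfSingularities.Theorems.WeightedInvariantIota3TauStrat
import Summits.ResolutionOfSingularities.ResolutionOfSingularities.Theorems.WeightedInvariantIota3Sigma
import Summits.ResolutionOfSingularities.ResolutionOfSingularities.Theorems.WeightedInvariantHypersurfaceLocalGameEFT4SDimLEDoor
import HarnessLib

/-!
# (c7)≤3 for the invariant of record `ι₃ᵗ = Iota3.iotaFlatT` BY NAME — (o44) part (c7-cyl), the named corollary asked by the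
# registrar (door `HypersurfaceCentreConstruction`, stmt-ResolutionOfSingularities-19897; rung P3 `stub_keyRungLE_three`;
# res-type-005, res-L1-w43-plan-1 GO 2026-08-27T13:37:40Z)

Topic: `Summits/ResolutionOfSingularities/ResolutionOfSingularities/Theorems`. Helper for the door item
`HypersurfaceCentreConstruction` (stmt-ResolutionOfSingularities-19897, route `WeightedInvariant`), def-free sequel of
`…ContactCylinderStratumLocalize` (p535733).  `Iota3.iotaFlatT = iotaLex ((ω+1)·ω) iotaOrdEpsTau (iotaCylinder iotaOrdEpsTau
iotaSigma)` (res-type-013, p532999).  At every regular local ring `S` of Krull dimension `≤ 3` and EVERY `f ∈ S`, for every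
prime `𝔭`: `iotaFlatT (S_𝔭) (f/1) ≤ iotaFlatT S f` — from (c7) for the stratifier `ι₀ = iotaOrdEpsTau` (res-type-013's
`iotaOrdEpsTau_generizationMonotone`, unrestricted), the (strat-τ) identification `topStratum ι₀ S f = V(P)` at `0 ≠ f ∈ 𝔪`
(res-type-013's `topStratum_iotaOrdEpsTau_eq`, one letter up from res-type-078's p528738) — and `= Spec S = V(⊥)` at the junk
arguments `0` / units (no tie position there: `IsTiePosition.ne_zero` / `.mem_maximalIdeal`) —, the bound
`iotaSigma_boundedBy` (res-type-073 p528355) and the localisation of the cylinder reading `iotaLex_iotaCylinder_localization_le`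
(p535733).  Hence **`Iota3.iotaFlatT_generizationMonotoneLE (p) : IotaGenerizationMonotoneLE 3 p Iota3.iotaFlatT`** — the (c7)
conjunct of `PRungLE 3 p iotaFlatT J` (res-type-098's Door module p532502) closes BY NAME, for every `p` and with the field
binders idle.  The unrestricted `IotaGenerizationMonotone iotaFlatT` is NOT claimed: (strat-τ) is a dimension-`≤ 3` theorem.
[OURS · L1 W4.3 · (o44) (c7-cyl)]  Replaces the role of NO printed item; NOT a statement of the manuscript
[claim: Hironaka2017, status: under-review]. AI work, weaker than expert review.

## References

* H. Matsumura, Commutative Ring Theory (1987), Thm. 4.3. [Matsumura1987]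
* res-L1-w43-plan-1, IOTA3-DESIGN v1.3.1 §9.5 (c7-cyl); RULING gen 11 #3 (the restricted clause `IotaGenerizationMonotoneLE`) (OURS).
-/

noncomputable section

open IsLocalRing Literature.AlgebraicGeometry.Resolution
open Summit.ResolutionOfSingularities.ResolutionOfSingularities.Theorems
open Summit.ResolutionOfSingularities.ResolutionOfSingularities.Theorems.ContactCylinder

set_option linter.dupNamespace false -- mandated namespace of this single-conjunct summit

namespace Summit.ResolutionOfSingularities.ResolutionOfSingularities.Cruxes.HypersurfaceCentreConstruction.LocalEngine

namespace Iota3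

/-- The junk arguments have the whole spectrum as top `ι₀`-stratum, i.e. `V(⊥)`: `f = 0`. [folklore] -/
theorem topStratum_iotaOrdEpsTau_zero_eq_bot (S : Type) [CommRing S] [IsRegularLocalRing S] (hdim : ringKrullDim S ≤ 3) :
    topStratum iotaOrdEpsTau S (0 : S) = {𝔮 | (⊥ : Ideal S) ≤ 𝔮.asIdeal} := by
  rw [topStratum_iotaOrdEpsTau_eq_topStratum_iotaOrdEps hdim (fun h => h.ne_zero rfl), topStratum_iotaOrdEps_zero]
  ext 𝔮
  simp

/-- The junk arguments have the whole spectrum as top `ι₀`-stratum, i.e. `V(⊥)`: `f` a unit. [folklore] -/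
theorem topStratum_iotaOrdEpsTau_of_isUnit_eq_bot (S : Type) [CommRing S] [IsRegularLocalRing S]
    (hdim : ringKrullDim S ≤ 3) {f : S} (hf : IsUnit f) :
    topStratum iotaOrdEpsTau S f = {𝔮 | (⊥ : Ideal S) ≤ 𝔮.asIdeal} := by
  have hnt : ¬ IsTiePosition S f := fun h =>
    (IsLocalRing.mem_maximalIdeal f).mp h.mem_maximalIdeal hf
  rw [topStratum_iotaOrdEpsTau_eq_topStratum_iotaOrdEps hdim hnt, topStratum_iotaOrdEps_of_isUnit S hf]
  ext 𝔮
  simp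

/-- **(c7) for `ι₃ᵗ` at every position of Krull dimension `≤ 3`**: `iotaFlatT (S_𝔭) (f/1) ≤ iotaFlatT S f` for `S` regular local
with `ringKrullDim S ≤ 3`, every `f` and every prime `𝔭` — (c7) for `ι₀`, the (strat-τ) identification (or `V(⊥)` at the junk
arguments) and the localisation of the cylinder reading (`iotaLex_iotaCylinder_localization_le`); NO monotonicity of `σ` is used.
[OURS · L1 W4.3 · (o44) (c7-cyl)] -/
theorem iotaFlatT_localization_le (S : Type) [CommRing S] [IsRegularLocalRing S] (hdim : ringKrullDim S ≤ 3) (f : S)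
    (𝔭 : Ideal S) [𝔭.IsPrime] :
    iotaFlatT (Localization.AtPrime 𝔭) (algebraMap S (Localization.AtPrime 𝔭) f) ≤ iotaFlatT S f := by
  haveI := isDomain_of_isRegularLocalRing S
  have h7 := iotaOrdEpsTau_generizationMonotone S 𝔭 f
  have hb : IotaBoundedBy ((Ordinal.omega0 + 1) * Ordinal.omega0) (iotaCylinder iotaOrdEpsTau iotaSigma) :=
    iotaBoundedBy_iotaCylinder iotaSigma_boundedBy
  have key : ∀ (P : Ideal S) [P.IsPrime], topStratum iotaOrdEpsTau S f = {𝔮 | P ≤ 𝔮.asIdeal} →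
      iotaFlatT (Localization.AtPrime 𝔭) (algebraMap S (Localization.AtPrime 𝔭) f) ≤ iotaFlatT S f := fun P _ hE => by
    unfold iotaFlatT
    exact iotaLex_iotaCylinder_localization_le iotaOrdEpsTau_isoInvariant iotaSigma_isoInvariant hb S f hE 𝔭 h7
  by_cases hf0 : f = 0
  · subst hf0
    exact key ⊥ (topStratum_iotaOrdEpsTau_zero_eq_bot S hdim)
  by_cases hfu : IsUnit f
  · exact key ⊥ (topStratum_iotaOrdEpsTau_of_isUnit_eq_bot S hdim hfu)
  · have hf : f ∈ maximalIdeal S := (IsLocalRing.mem_maximalIdeal f).mpr (mem_nonunits_iff.mpr hfu)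
    obtain ⟨P, hP, -, -, hE⟩ := topStratum_iotaOrdEpsTau_eq hdim hf0 hf
    haveI := hP
    exact key P hE

/-- **THE (c7)≤3 CONJUNCT OF THE P3 RUNG FOR THE INVARIANT OF RECORD, BY NAME**:
`IotaGenerizationMonotoneLE 3 p Iota3.iotaFlatT` for every `p` (the field binders of the restricted clause are idle; only
`IsRegularLocalRing S` and `ringKrullDim S ≤ 3` are used). [OURS · L1 W4.3 · (o44) (c7-cyl)] -/
theorem iotaFlatT_generizationMonotoneLE (p : ℕ) : IotaGenerizationMonotoneLE 3 p iotaFlatT := by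
  intro k₀ _ _ _ S _ _ _ _ 𝔭 _ f hdim
  exact iotaFlatT_localization_le S hdim f 𝔭

end Iota3

end Summit.ResolutionOfSingularities.ResolutionOfSingularities.Cruxes.HypersurfaceCentreConstruction.LocalEngine

end
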